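import Summits.NavierStokesRegularity.NavierStokesRegularity.Theses.PumpContinuation
import Summits.NavierStokesRegularity.NavierStokesRegularity.Theorems.PumpContinuationEulerProximatePumpScalingTools
import Summits.NavierStokesRegularity.NavierStokesRegularity.Theorems.PerpetualPumpThesisBilinearOperatorForm
import Literature.Analysis.FluidPDE.TaoAveragedComplexAverageReal

/-!
# Route PumpContinuation · crux `EulerProximatePump` — stub `stub_doorOfAccumulating` (line `SketchIdeator2`)

Bookkeeping step "amplitude normalisation ⇒ Door" of the transfer line for the crux
`Theses.PumpContinuation.EulerProximatePump` (stmt-NavierStokesRegularity-18302).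

Suppose that, for a symmetric cancelling averaging datum `𝒜` and a ceiling `M`, the perturbed trilinear
forms `B + η B̃_𝒜` (`B = eulerForm`, `B̃_𝒜 = 𝒜.form`, Tao 2016 (1.3), (1.13)) carry Schwartz-data
`H¹⁰_df`-mild Type-I blow-ups at ceiling `M` with no mild extension, for parameters `η > 0` accumulating
at `0⁺`. Then the Door holds: given `δ > 0` pick such an `η < min(1, δ)`, put `c := 1 + η` and
`θ := c⁻¹ ∈ (1 - δ, 1)`. The segment form `T_θ = (1-θ) B̃_𝒜 + θ B` satisfies the homogeneity relation
`T_θ(c a, c b, w) = c · (B + η B̃_𝒜)(a, b, w)` (`segForm_smul`: both forms are homogeneous of degree one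
in each of the first two slots, and `(1-θ)c² = c η`, `θ c² = c`), so the landed scaling covariance of
Tao's mild formulation (1.15) (`typeIBlowup_smul`, module `…ScalingTools`) carries the blow-up of
`B + η B̃_𝒜` to one of `T_θ` with datum `c u₀`, the same blow-up time, ceiling `c M ≤ 2|M|` and no mild
extension. The fixed ceiling of the Door witness is `2|M|`.

The file ends with the registered stub `stub_doorOfAccumulating` (its exact registered signature).

## References

* T. Tao, *Finite time blowup for an averaged three-dimensional Navier–Stokes equation*, J. Amer. Math.
  Soc. 29 (2016), arXiv:1402.0290v3, §1.1 (1.3), (1.13), (1.15). [Tao2016AveragedNS]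
-/

noncomputable section

-- the nested summit namespace `…NavierStokesRegularity.NavierStokesRegularity…` is the tree's layout (D-0017)
set_option linter.dupNamespace false

open MeasureTheory Set Filter Topology
open scoped ENNReal
open Literature.Analysis.FluidPDE Literature.Analysis.FluidPDE.Tao2016

namespace Summit.NavierStokesRegularity.NavierStokesRegularity.Theorems.PumpContinuationEulerProximatePump

namespace DoorOfAccumulating

open PerpetualPumpThesis.B (form_smul₁ form_smul₂)

/-! ### Homogeneity of the segment form under the amplitude scaling -/

/-- **Homogeneity of the Euler form in its second slot**: `⟨B(x, k y), z⟩ = k ⟨B(x,y), z⟩`, from the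
symmetry of `B` and its homogeneity in the first slot (no convergence needed). [cite: Tao2016AveragedNS, §1.1 (1.3)] -/
theorem eulerForm_smul₂ (k : ℂ) (x y z : L2C) : eulerForm x (k • y) z = k * eulerForm x y z := by
  rw [eulerForm_symm, eulerForm_smul₁, eulerForm_symm]

/-- **The scalar identity behind the normalisation**: if `θ c = 1` and `c = 1 + η` then, as complex
numbers, `θ · c = 1` and `(1 - θ) · c = η`. [folklore] -/
theorem scalars_of_theta_mul {η θ c : ℝ} (hθc : θ * c = 1) (hc : c = 1 + η) :
    ((θ : ℝ) : ℂ) * ((c : ℝ) : ℂ) = 1 ∧ ((1 - θ : ℝ) : ℂ) * ((c : ℝ) : ℂ) = ((η : ℝ) : ℂ) := by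
  refine ⟨?_, ?_⟩
  · rw [← Complex.ofReal_mul, hθc, Complex.ofReal_one]
  · rw [← Complex.ofReal_mul]
    congr 1
    rw [sub_mul, hθc, hc]
    ring

/-- **Homogeneity relation between the segment form and the perturbed form.** For `c = 1 + η` and
`θ = c⁻¹`, the segment form `T_θ = (1-θ) B̃_𝒜 + θ B` evaluated at `(c a, c b, w)` is `c` times the
perturbed form `B + η B̃_𝒜` at `(a, b, w)`: both `B̃_𝒜` (`form_smul₁`, `form_smul₂`) and `B`
(`eulerForm_smul₁`, `eulerForm_smul₂`) are homogeneous of degree one in each of the first two slots, and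
`(1-θ) c² = c η`, `θ c² = c`. [cite: Tao2016AveragedNS, §1.1 (1.3), (1.13)] -/
theorem segForm_smul (𝒜 : AveragingDatum) {η θ c : ℝ} (hθc : θ * c = 1) (hc : c = 1 + η)
    (a b w : L2C) :
    ((1 - θ : ℝ) : ℂ) * 𝒜.form (((c : ℝ) : ℂ) • a) (((c : ℝ) : ℂ) • b) w +
        ((θ : ℝ) : ℂ) * eulerForm (((c : ℝ) : ℂ) • a) (((c : ℝ) : ℂ) • b) w =
      ((c : ℝ) : ℂ) * (eulerForm a b w + ((η : ℝ) : ℂ) * 𝒜.form a b w) := by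
  obtain ⟨h1, h2⟩ := scalars_of_theta_mul hθc hc
  rw [form_smul₁, form_smul₂, eulerForm_smul₁, eulerForm_smul₂]
  linear_combination (((c : ℝ) : ℂ) * 𝒜.form a b w) * h2 + (((c : ℝ) : ℂ) * eulerForm a b w) * h1

/-! ### The parameter `θ = 1/(1+η)` and the ceiling -/

/-- **The Door parameter.** For `0 < η < δ`, `c = 1 + η` and `θ c = 1` (i.e. `θ = 1/(1+η)`):
`1 - δ < θ < 1` and `0 ≤ θ` (indeed `1 - η ≤ θ` as `(1-η)(1+η) ≤ 1`). [folklore] -/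
theorem theta_bounds {η δ θ c : ℝ} (hη : 0 < η) (hηδ : η < δ) (hc : c = 1 + η) (hθc : θ * c = 1) :
    1 - δ < θ ∧ θ < 1 ∧ 0 ≤ θ := by
  have hcpos : 0 < c := by rw [hc]; linarith
  have hθc' : 0 < θ * c := by rw [hθc]; exact one_pos
  have hθpos : 0 < θ := pos_of_mul_pos_left hθc' hcpos.le
  have h1 : 1 - η ≤ θ := by
    have h' : (1 - η) * c ≤ θ * c := by rw [hθc, hc]; nlinarith [sq_nonneg η]
    exact le_of_mul_le_mul_right h' hcpos
  have h2 : θ < 1 := by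
    have h' : θ * c < 1 * c := by rw [hθc, hc]; linarith
    exact lt_of_mul_lt_mul_right h' hcpos.le
  exact ⟨by linarith, h2, hθpos.le⟩

/-- **The ceiling.** For `0 < c ≤ 2`, `c M ≤ 2 |M|`. [folklore] -/
theorem ceiling_le {c : ℝ} (hc : 0 < c) (hc2 : c ≤ 2) (M : ℝ) : c * M ≤ 2 * |M| :=
  (mul_le_mul_of_nonneg_left (le_abs_self M) hc.le).trans
    (mul_le_mul_of_nonneg_right hc2 (abs_nonneg M))

/-- Monotonicity of the Type-I bound in the ceiling: `ofReal (c M / √τ) ≤ ofReal (2|M| / √τ)` for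
`0 < c ≤ 2`. [folklore] -/
theorem rate_mono {c : ℝ} (hc : 0 < c) (hc2 : c ≤ 2) (M τ : ℝ) :
    ENNReal.ofReal (c * M / Real.sqrt τ) ≤ ENNReal.ofReal (2 * |M| / Real.sqrt τ) :=
  ENNReal.ofReal_le_ofReal (div_le_div_of_nonneg_right (ceiling_le hc hc2 M) (Real.sqrt_nonneg _))

end DoorOfAccumulating

open DoorOfAccumulating

/-! ### The registered stub -/

/-- **Stub (bookkeeping, amplitude normalisation ⇒ Door).** If, for a symmetric cancelling datum `𝒜` and a
ceiling `M`, the perturbed forms `B + η B̃_𝒜` have Schwartz-data `H¹⁰_df`-mild Type-I blow-ups at ceiling `M`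
with no mild extension for parameters `η` ACCUMULATING at `0⁺`, then the Door holds: with `θ := 1/(1+η)`
the segment form is `T_θ = θ · (B + η B̃_𝒜)`, and `u ↦ (1+η) u` maps mild solutions of `B + ηB̃` to mild
solutions of `T_θ` (datum `(1+η) u₀`, ceiling `(1+η)M ≤ 2|M|`, non-extension preserved by the inverse scaling).
[cite: Tao2016AveragedNS, §1.1 (1.15)] -/
theorem stub_doorOfAccumulating :
    (∃ 𝒜 : AveragingDatum, 𝒜.IsSymmetric ∧ 𝒜.HasCancellation ∧ ∃ M : ℝ, ∀ η₀ : ℝ, 0 < η₀ →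
      ∃ η : ℝ, 0 < η ∧ η < η₀ ∧
        ∃ u₀ : SchwartzMap (EuclideanSpace ℝ (Fin 3)) (EuclideanSpace ℝ (Fin 3)),
          VectorCalculus.IsDivFree ⇑u₀ ∧ ∃ S : ℝ, 0 < S ∧ ∃ u : ℝ → L2C,
            IsMildSolutionFor (fun a b c => eulerForm a b c + ((η : ℝ) : ℂ) * 𝒜.form a b c)
              (schwartzL2 u₀) (Ico 0 S) u ∧
            (∀ t ∈ Ico 0 S, eLpNorm (u t) ⊤ volume ≤ ENNReal.ofReal (M / Real.sqrt (S - t))) ∧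
            ¬ ∃ S' : ℝ, S < S' ∧ ∃ v : ℝ → L2C,
                IsMildSolutionFor (fun a b c => eulerForm a b c + ((η : ℝ) : ℂ) * 𝒜.form a b c)
                  (schwartzL2 u₀) (Ico 0 S') v ∧ ∀ t ∈ Ico 0 S, v t = u t) →
    Theses.PumpContinuation.EulerProximatePump := by
  rintro ⟨𝒜, hs, hcanc, M, hM⟩
  refine ⟨𝒜, hs, hcanc, 2 * |M|, fun δ hδ => ?_⟩
  -- a parameter `η < min 1 δ` from the accumulation hypothesis
  obtain ⟨η, hη, hη₀, hwit⟩ := hM (min 1 δ) (lt_min one_pos hδ)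
  have hη1 : η < 1 := lt_of_lt_of_le hη₀ (min_le_left _ _)
  have hηδ : η < δ := lt_of_lt_of_le hη₀ (min_le_right _ _)
  -- the amplitude `c = 1 + η` and the segment parameter `θ = c⁻¹`
  obtain ⟨c, hc⟩ : ∃ c : ℝ, c = 1 + η := ⟨_, rfl⟩
  have hcpos : 0 < c := by rw [hc]; linarith
  have hc2 : c ≤ 2 := by rw [hc]; linarith
  obtain ⟨θ, hθ⟩ : ∃ θ : ℝ, θ = c⁻¹ := ⟨_, rfl⟩
  have hθc : θ * c = 1 := by rw [hθ]; exact inv_mul_cancel₀ hcpos.ne'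
  obtain ⟨hθδ, hθ1, hθ0⟩ := theta_bounds hη hηδ hc hθc
  refine ⟨θ, hθδ, hθ1, hθ0, ?_⟩
  -- transport the witness along `u ↦ c u` (scaling covariance of the mild formulation)
  have key := typeIBlowup_smul
    (T := fun a b w => eulerForm a b w + ((η : ℝ) : ℂ) * 𝒜.form a b w)
    (T' := fun a b w => ((1 - θ : ℝ) : ℂ) * 𝒜.form a b w + ((θ : ℝ) : ℂ) * eulerForm a b w)
    c hcpos (fun a b w => segForm_smul 𝒜 hθc hc a b w) M hwit
  obtain ⟨u₀, hdiv, S, hS, u, hu, hrate, hnoext⟩ := key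
  exact ⟨u₀, hdiv, S, hS, u, hu, fun t ht => (hrate t ht).trans (rate_mono hcpos hc2 M _), hnoext⟩

end Summit.NavierStokesRegularity.NavierStokesRegularity.Theorems.PumpContinuationEulerProximatePump

end
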